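import Summits.HodgeConjecture.HodgeConjecture.Theorems.PadicSemiregularLiftHodgeFermatVarietiesStubEigenspaceStructureAffine
import Literature.AlgebraicGeometry.HodgeTheory.FermatEigenspaceRestriction
import Literature.AlgebraicGeometry.HodgeTheory.FermatClaimPermutationInvariance
import HarnessLib

/-!
# The topological conjuncts (E2) ∧ (E0) of the eigenspace structure of `H²ᵖ(X²ᵖₘ(ℂ); ℂ)`

Route `PadicSemiregularLift` of `HodgeConjecture`, crux `HodgeFermatVarieties`
(stmt-HodgeConjecture-1334: the Hodge conjecture for the complex Fermat hypersurfaces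
`Xⁿₘ : Σ xᵢᵐ = 0 ⊂ ℙⁿ⁺¹`), line `cancel-by-any-claim-lattice`, stub `stub_eigenspacePham` (S5a): the
two TOPOLOGICAL conjuncts of the eigenspace input `hE` of the per-degree assembly
`hodgeClasses_algebraic_fermat_of_claims_at'` / `mem_algebraicClasses_fermat_middle_of_eigenspaces`
for the standard model `X²ᵖₘ = V₊(Σ xᵢᵐ) ⊂ ℙ²ᵖ⁺¹`, for every `m ≥ 1` and `p ≥ 1`
(Ran 1980 Prop. 1.7 (i) / Shioda 1979 on the real carriers):

* (E2) `stub_eigenspaceStructure_E2` — **the eigenspace `V(α) ⊆ H²ᵖ(X²ᵖₘ(ℂ); ℂ)` of a NON-ZERO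
  character `α` of `μₘ²ᵖ⁺²` with SOME zero coordinate `αᵢ = 0` is `⊥`**;
* (E0) `stub_eigenspaceStructure_E0` — **the invariant classes `V(0) ⊆ H²ᵖ(X²ᵖₘ(ℂ); ℂ)` are
  restricted from `ℙ²ᵖ⁺¹(ℂ)`** (they lie in the range of `ι^*`);
* `stub_eigenspacePham` — their conjunction, verbatim the registered stub.

Everything is PROVED from the tree (no named fact, no hypothesis). The proof is the printed one
(Ran §1 Lemma 1.4, (1.5), Prop. 1.7 (i); Shioda, Math. Ann. 245 §1; Pham 1965 / Milnor 1968 §9 on the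
affine piece):

* `eigenspacePham_restrictCompl_map_diagonalMap` — restriction to the affine piece
  `U_k(ℂ) = {x_k ≠ 0}` intertwines the diagonal symmetry `g_a` of `Xᴺₘ(ℂ)` with its restriction
  `diagonalMapCompl k a` to `U_k(ℂ)`;
* `eigenspacePham_restrictCompl_eq_zero_of_apply_eq_zero` — a class of `V(α)` with `α_s = 0`,
  `s = k.succAbove (last)`, restricts to a class of `Hᵈ(U_k(ℂ); ℂ)` fixed by the `μₘ` of the slot `s`
  (`χ_α(1, …, ζ, …, 1) = ζ^{⟨α_s⟩} = 1`), which for `d ≠ 0` VANISHES by the landed affine layer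
  `eigenspaceStructure_affine_eq_zero` (Pham: the Milnor fibre `{Σ zⱼᵐ = 1}` retracts equivariantly
  onto the join `μₘ * ⋯ * μₘ`, on whose positive-degree cohomology the rotations of one factor have
  no invariants);
* `eigenspacePham_eq_bot_of_apply_succAbove` — hence `V(α) = ⊥` for `α ≠ 0` with `α_s = 0`,
  restriction to `U_k(ℂ)` being injective on `V(α)`, `α ≠ 0`
  (`restrictCompl_injOn_fermatEigenspace'`: its kernel is the line of ambient classes, on which
  `μₘᴺ⁺²` acts trivially);
* `eigenspacePham_eq_bot_of_exists_apply_eq_zero` — and `V(α) = ⊥` for `α ≠ 0` with ANY zero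
  coordinate `αᵢ = 0`, by the coordinate transposition `(i s)`: `p_π^* V(α) ⊆ V(α ∘ π⁻¹)`
  (`map_permMap_mem_fermatEigenspace`) and `p_{π⁻¹}^* p_π^* = id`;
* `eigenspacePham_zero_le_range` — an invariant class restricts to an invariant class of
  `Hᵈ(U_0(ℂ); ℂ)`, which is `0` by the affine layer, so it lies in the kernel of restriction, the
  line `ℂ · ι^* γ` (`ker_restrictCompl_fermatCoordHyperplane_le_span`, Thom–Gysin + Lefschetz).

References: [Ran1980] Z. Ran, Cycles on Fermat hypersurfaces, Compositio Math. 42 (1980) 121–142,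
§1 Lemma 1.4, (1.5), Prop. 1.7 (i); [Shioda1979PJA] T. Shioda, Proc. Japan Acad. 55A (1979)
111–114, §4; [Aoki1987] N. Aoki, J. Math. Soc. Japan 39 (1987), p. 385.
-/

set_option linter.dupNamespace false

noncomputable section

open CategoryTheory AlgebraicGeometry Finset
open Literature.AlgebraicGeometry Literature.AlgebraicGeometry.Motives
open Literature.AlgebraicGeometry.HodgeTheory Literature.AlgebraicGeometry.HodgeTheory.FermatCharacter
open Literature.AlgebraicTopology.SingularHomology

namespace Summit.HodgeConjecture.HodgeConjecture.Theorems.CancelByAnyClaimLattice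

variable {n m : ℕ}

/-! ### Restriction to the affine piece and the diagonal symmetries -/

/-- **Restriction to `U_k(ℂ)` intertwines `g_a^*` with `(g_a|_{U_k})^*`**: the inclusion
`U_k(ℂ) ↪ Xᴺₘ(ℂ)` commutes with the diagonal symmetry (`subtype_val_comp_diagonalMapCompl`).
[cite: Ran1980, §1 Lemma 1.4] -/
theorem eigenspacePham_restrictCompl_map_diagonalMap (k : Fin (n + 2)) (a : fermatGroup n m) (d : ℕ)
    (c : complexBetti (fermatHypersurface n m) d) :
    complexBetti.restrictCompl (fermatHypersurface n m) (fermatCoordHyperplane n m k) d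
        (singularCohomology.map ℂ ℂ
          (diagonalMap (fermatPolynomial ℂ n m) (fermatGroup_le_diagonalStabilizer m a.2)) d c) =
      singularCohomology.map ℂ ℂ (diagonalMapCompl k a) d
        (complexBetti.restrictCompl (fermatHypersurface n m) (fermatCoordHyperplane n m k) d c) := by
  rw [complexBetti.restrictCompl, ← ModuleCat.comp_apply, ← ModuleCat.comp_apply,
    ← singularCohomology.map_comp, ← singularCohomology.map_comp, subtype_val_comp_diagonalMapCompl]

/-- **A class of `V(α)` with `α_s = 0`, `s = k.succAbove (last)`, dies on `U_k(ℂ)` in positive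
degree**: its restriction is fixed by the symmetries `(1, …, ζ, …, 1)`, `ζ ∈ μₘ` in slot `s`
(`χ_α` of such a symmetry is `ζ^{⟨α_s⟩} = 1`), and no non-zero class of `Hᵈ(U_k(ℂ); ℂ)`, `d ≠ 0`,
is so fixed (the affine layer `eigenspaceStructure_affine_eq_zero`: Pham's theorem on the Milnor
fibre `{Σ zⱼᵐ = 1} ≅ U_k(ℂ)`). [cite: Ran1980, §1 Lemma 1.4 and Prop. 1.7 (i)] -/
theorem eigenspacePham_restrictCompl_eq_zero_of_apply_eq_zero (hn : 1 ≤ n) (hm : m ≠ 0)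
    (k : Fin (n + 2)) {d : ℕ} (hd : d ≠ 0) {α : Fin (n + 2) → ZMod m}
    (hk : α (k.succAbove (Fin.last n)) = 0) {c : complexBetti (fermatHypersurface n m) d}
    (hc : c ∈ fermatEigenspace m α d) :
    complexBetti.restrictCompl (fermatHypersurface n m) (fermatCoordHyperplane n m k) d c = 0 := by
  refine eigenspaceStructure_affine_eq_zero hn hm k hd _ fun ζ ↦ ?_
  rw [← eigenspacePham_restrictCompl_map_diagonalMap, mem_fermatEigenspace_iff.mp hc,
    fermatCharacter_fermatGroupSingle, hk, ZMod.val_zero, pow_zero, Units.val_one, one_smul]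

/-- **`V(α) = ⊥` for `α ≠ 0` vanishing at the slot `k.succAbove (last)`** (`Xᴺₘ`, `m ≥ 1`, degree
`d = 2p + 2 ≤ N`): a class of `V(α)` dies on `U_k(ℂ)` (previous lemma), and restriction to
`U_k(ℂ)` is injective on `V(α)` for `α ≠ 0` (`restrictCompl_injOn_fermatEigenspace'`: the kernel is
the line of ambient classes, fixed by `μₘᴺ⁺²`, while `χ_α ≠ 1`).
[cite: Ran1980, §1 (1.5) and Prop. 1.7 (i)] [cite: Aoki1987, p. 385] -/
theorem eigenspacePham_eq_bot_of_apply_succAbove (hm : 1 ≤ m) {N d p : ℕ} (hN : 2 * p + 2 ≤ N)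
    (hd : d = 2 * p + 2) (k : Fin (N + 2)) {α : Fin (N + 2) → ZMod m} (hα : α ≠ 0)
    (hk : α (k.succAbove (Fin.last N)) = 0) :
    fermatEigenspace m α d = ⊥ := by
  rw [eq_bot_iff]
  intro c hc
  rw [Submodule.mem_bot]
  have h0 : complexBetti.restrictCompl (fermatHypersurface N m) (fermatCoordHyperplane N m k) d c =
      complexBetti.restrictCompl (fermatHypersurface N m) (fermatCoordHyperplane N m k) d 0 := by
    rw [map_zero]
    exact eigenspacePham_restrictCompl_eq_zero_of_apply_eq_zero (by omega) (by omega) k (by omega) hk hc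
  exact restrictCompl_injOn_fermatEigenspace' hm hN hd k hα hc (Submodule.zero_mem _) h0

/-- **(E2) in general indexing: `V(α) = ⊥` for `α ≠ 0` with SOME zero coordinate `αᵢ = 0`**
(`Xᴺₘ`, `m ≥ 1`, degree `d = 2p + 2 ≤ N`). The coordinate transposition `π = (i s)`,
`s = 0.succAbove (last)`, carries `V(α)` into `V(α ∘ π⁻¹)` (`map_permMap_mem_fermatEigenspace`),
and `(α ∘ π⁻¹)_s = αᵢ = 0`, so `p_π^* c = 0` by the previous lemma and
`c = p_{π⁻¹}^* p_π^* c = 0`. [cite: Ran1980, §1 Prop. 1.7 (i)] [cite: Shioda1979PJA, §4] -/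
theorem eigenspacePham_eq_bot_of_exists_apply_eq_zero (hm : 1 ≤ m) {N d p : ℕ} (hN : 2 * p + 2 ≤ N)
    (hd : d = 2 * p + 2) {α : Fin (N + 2) → ZMod m} (hα : α ≠ 0) (hi : ∃ i, α i = 0) :
    fermatEigenspace m α d = ⊥ := by
  obtain ⟨i, hi⟩ := hi
  set s : Fin (N + 2) := (0 : Fin (N + 2)).succAbove (Fin.last N) with hs
  set π : Equiv.Perm (Fin (N + 2)) := Equiv.swap i s with hπ
  have hβ : α ∘ π.symm ≠ 0 := by
    intro h
    apply hα
    funext j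
    have hj := congrFun h (π j)
    rwa [Function.comp_apply, Equiv.symm_apply_apply] at hj
  have hβs : (α ∘ π.symm) s = 0 := by
    rw [Function.comp_apply, hπ, Equiv.symm_swap, Equiv.swap_apply_right, hi]
  have hbot := eigenspacePham_eq_bot_of_apply_succAbove hm hN hd 0 hβ hβs
  rw [eq_bot_iff]
  intro c hc
  have h1 := map_permMap_mem_fermatEigenspace π hc
  rw [hbot, Submodule.mem_bot] at h1
  rw [Submodule.mem_bot, ← map_permMap_inv_map_permMap (mem_permStabilizer_fermatPolynomial m π) d c,
    h1, map_zero]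

/-! ### The invariant classes are restricted from projective space -/

/-- **(E0), indexing `Xⁿ⁺¹ₘ ⊂ ℙⁿ⁺²`, degree `2p + 2`, `2p < n`**: an invariant class
`c ∈ V(0) ⊆ H²ᵖ⁺²(Xⁿ⁺¹ₘ(ℂ); ℂ)` restricts to an invariant class of `H²ᵖ⁺²(U_0(ℂ); ℂ)`, which
vanishes (affine layer), so `c` lies in the kernel of restriction to `U_0(ℂ)`, the line `ℂ · ι^* γ`
of an ambient class (`ker_restrictCompl_fermatCoordHyperplane_le_span`); hence `c = ι^*(t γ)`.
[cite: Ran1980, §1 Lemma 1.4 and (1.5)] -/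
theorem eigenspacePham_zero_le_range_aux (hn : 1 ≤ n) (hm : 1 ≤ m) {p : ℕ} (hp : 2 * p < n) :
    fermatEigenspace m (0 : Fin (n + 3) → ZMod m) (2 * p + 2) ≤
      LinearMap.range (complexBetti.map
        (SmoothHypersurface.hypersurfaceι (fermatPolynomial ℂ (n + 1) m)) (2 * p + 2)).hom := by
  intro c hc
  have hr : complexBetti.restrictCompl (fermatHypersurface (n + 1) m)
      (fermatCoordHyperplane (n + 1) m 0) (2 * p + 2) c = 0 :=
    eigenspacePham_restrictCompl_eq_zero_of_apply_eq_zero (n := n + 1) (by omega) (by omega) 0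
      (by omega) rfl hc
  obtain ⟨γ, -, hle⟩ := ker_restrictCompl_fermatCoordHyperplane_le_span hn hm (0 : Fin (n + 3)) hp
  obtain ⟨t, ht⟩ := Submodule.mem_span_singleton.mp (hle (LinearMap.mem_ker.mpr hr))
  exact ⟨t • γ, by rw [map_smul]; exact ht⟩

/-- **(E0) in general indexing** (`Xᴺₘ`, `m ≥ 1`, degree `d = 2p + 2 ≤ N`): the invariant classes
`V(0) ⊆ Hᵈ(Xᴺₘ(ℂ); ℂ)` lie in the range of `ι^* : Hᵈ(ℙᴺ⁺¹(ℂ)) → Hᵈ(Xᴺₘ(ℂ))`.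
[cite: Ran1980, §1 Lemma 1.4 and (1.5)] -/
theorem eigenspacePham_zero_le_range (hm : 1 ≤ m) {N d p : ℕ} (hN : 2 * p + 2 ≤ N) (hd : d = 2 * p + 2) :
    fermatEigenspace m (0 : Fin (N + 2) → ZMod m) d ≤
      LinearMap.range (complexBetti.map
        (SmoothHypersurface.hypersurfaceι (fermatPolynomial ℂ N m)) d).hom := by
  obtain ⟨n, rfl⟩ : ∃ n, N = n + 1 := ⟨N - 1, by omega⟩
  subst hd
  exact eigenspacePham_zero_le_range_aux (n := n) (by omega) hm (by omega)

/-! ### The registered statements -/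

/-- **S5 (E2) `stub_eigenspaceStructure_E2`**: for `m ≥ 1`, `p > 0`, on the standard model
`X²ᵖₘ = V₊(Σ xᵢᵐ) ⊂ ℙ²ᵖ⁺¹`, the eigenspace in `H²ᵖ(X²ᵖₘ(ℂ); ℂ)` of a non-zero character of
`μₘ²ᵖ⁺²` with a zero coordinate is `⊥` (Pham's theorem on the affine pieces + injectivity of
restriction on `V(α)`, `α ≠ 0`, + coordinate transpositions).
[cite: Ran1980, §1 Prop. 1.7 (i)] [cite: Shioda1979PJA, §4] -/
theorem stub_eigenspaceStructure_E2 :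
    ∀ (m : ℕ) [NeZero m] ⦃p : ℕ⦄, 0 < p → ∀ α : Fin (2 * p + 2) → ZMod m, α ≠ 0 → (∃ i, α i = 0) →
      fermatEigenspace m α (2 * p) = ⊥ :=
  fun m _ p hp _ hα hi ↦ eigenspacePham_eq_bot_of_exists_apply_eq_zero
    (Nat.one_le_iff_ne_zero.mpr (NeZero.ne m)) (N := 2 * p) (p := p - 1) (by omega) (by omega) hα hi

/-- **S5 (E0) `stub_eigenspaceStructure_E0`**: for `m ≥ 1`, `p > 0`, on the standard model
`X²ᵖₘ = V₊(Σ xᵢᵐ) ⊂ ℙ²ᵖ⁺¹`, the invariant classes of `H²ᵖ(X²ᵖₘ(ℂ); ℂ)` are restricted from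
`ℙ²ᵖ⁺¹(ℂ)` (Pham's theorem on the affine piece `U_0(ℂ)` + Thom–Gysin for the coordinate section +
Lefschetz below the middle). [cite: Ran1980, §1 Lemma 1.4 and Prop. 1.7 (i)] -/
theorem stub_eigenspaceStructure_E0 :
    ∀ (m : ℕ) [NeZero m] ⦃p : ℕ⦄, 0 < p →
      fermatEigenspace m (0 : Fin (2 * p + 2) → ZMod m) (2 * p) ≤
        LinearMap.range (complexBetti.map
          (SmoothHypersurface.hypersurfaceι (fermatPolynomial ℂ (2 * p) m)) (2 * p)).hom :=
  fun m _ p hp ↦ eigenspacePham_zero_le_range (Nat.one_le_iff_ne_zero.mpr (NeZero.ne m))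
    (N := 2 * p) (p := p - 1) (by omega) (by omega)

/-- **S5a `stub_eigenspacePham` — (E2) ∧ (E0), the topological conjuncts of the eigenspace
structure of `H²ᵖ(X²ᵖₘ(ℂ); ℂ)`** for every `m ≥ 1`, `p > 0`: verbatim the registered stub of the line
`cancel-by-any-claim-lattice` (the first two conjuncts of the hypothesis `hE` of
`hodgeClasses_algebraic_fermat_of_claims_at'`), assembled from `stub_eigenspaceStructure_E2` and
`stub_eigenspaceStructure_E0`. [cite: Ran1980, §1 Prop. 1.7 (i)] [cite: Shioda1979PJA, §4] -/
theorem stub_eigenspacePham :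
    ∀ (m : ℕ) [NeZero m] ⦃p : ℕ⦄, 0 < p →
      (∀ α : Fin (2 * p + 2) → ZMod m, α ≠ 0 → (∃ i, α i = 0) → fermatEigenspace m α (2 * p) = ⊥) ∧
      (fermatEigenspace m (0 : Fin (2 * p + 2) → ZMod m) (2 * p) ≤
        LinearMap.range (complexBetti.map (SmoothHypersurface.hypersurfaceι (fermatPolynomial ℂ (2 * p) m)) (2 * p)).hom) :=
  fun m _ _ hp ↦ ⟨stub_eigenspaceStructure_E2 m hp, stub_eigenspaceStructure_E0 m hp⟩

end Summit.HodgeConjecture.HodgeConjecture.Theorems.CancelByAnyClaimLattice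

end
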